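import Literature.AnabelianGeometry.SemiGraphs.PSCGraphicTransport
import HarnessLib

/-!
# [CombGC] Theorem 1.6 (i), sufficiency: group-theoretically cuspidal ⟹ numerically cuspidal

Mochizuki, *A combinatorial version of the Grothendieck conjecture*, Tohoku Math. J. **59** (2007)
[CombGC], §1, Theorem 1.6 (i), author's manuscript p. 13: "`α` is numerically cuspidal if and only
if it is group-theoretically cuspidal", proof p. 13: "Sufficiency is immediate [cf. Proposition
1.2, (i)]".  Proof-only companion of `PSCGraphicity.lean` (abc-iut-L3-t4; cone row
`CombGC:Thm1.6`, opened to wave-4 provers by abc-iut-L3-lead 2026-08-25T23:21:16Z; this file is the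
part (i) split of seat abc-iut-w4-d052), over the interface `PSCDatum Π`, for EVERY pair of data
`G`, `H` and every `α : Π_G ≅ Π_H` — no origin predicate:

* `PSCDatum.cusp_eq_of_smul_cuspGp_eq` — Prop. 1.2 (i) (edge-like case, the typed predicate
  `EdgeLikeOpenInterDeterminesEdge`) implies that distinct cusps have NON-conjugate cuspidal
  subgroups (conjugate subgroups meet in an open — indeed the whole — subgroup);
* `PSCDatum.exists_cuspEquiv_of_isGroupTheoreticallyCuspidal` — a group-theoretically cuspidal
  `α` (Def. 1.4 (iv)) between data satisfying Prop. 1.2 (i) induces a bijection `f` of cusps with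
  `α(Π_c)` conjugate to `Π'_{f c}` ("by considering conjugacy classes of … edge-like subgroups [and
  applying Proposition 1.2, (i)], `α` induces a bijection between the … edges", proof of Prop. 1.5
  (ii), p. 13, cuspidal part);
* `PSCDatum.isNumericallyCuspidal_of_isGroupTheoreticallyCuspidal` — **Thm. 1.6 (i), sufficiency**:
  then corresponding coverings have the same number of cusps, cusp by cusp
  `#(U \ Π / Π_c) = #(α U \ Π' / Π'_{f c})` (abc-iut-L3-t4's `card_doubleCoset_quotient_conj/_map`).

The hypotheses are the printed input BY NAME (Prop. 1.2 (i) for `G` and for `H`, typed in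
`PSCGraphicity.lean`); necessity (the amended route of [IUTchI] Rmk. 1.2.3 (iii)(iv)) is the
companion file `PSCCuspidalCriterionProofs.lean`.  Pure proofs; no definitions; nothing here takes a
side on [IUTchIII] Cor. 3.12. [cite: MochizukiCombGC2007, Thm 1.6(i) p.13]
-/

noncomputable section

namespace Literature.AnabelianGeometry.SemiGraphs

namespace PSCDatum

open scoped Pointwise

universe u

variable {P : Type u} [Group P] [TopologicalSpace P]
variable {P' : Type u} [Group P'] [TopologicalSpace P']

/-! ### Prop. 1.2 (i) ⟹ distinct cusps have non-conjugate cuspidal subgroups -/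

section Cusps

variable (G : PSCDatum P)

/-- **[CombGC] Prop. 1.2 (i)**, consequence used on p. 13: if `Π_G` satisfies the conclusion of
Prop. 1.2 (i) for edge-like subgroups, then conjugate cuspidal subgroups come from the SAME cusp —
`γ₁ Π_{c₁} γ₁⁻¹ = γ₂ Π_{c₂} γ₂⁻¹` forces `c₁ = c₂` (their intersection is everything, hence open).
[cite: MochizukiCombGC2007, Prop 1.2(i) p.8] -/
theorem cusp_eq_of_smul_cuspGp_eq (hG : G.EdgeLikeOpenInterDeterminesEdge) {c₁ c₂ : G.graph.C}
    {γ₁ γ₂ : ConjAct P} (h : γ₁ • G.cuspGp c₁ = γ₂ • G.cuspGp c₂) : c₁ = c₂ := by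
  have h' : γ₁ • G.edgeGp (Sum.inr c₁) = γ₂ • G.edgeGp (Sum.inr c₂) := h
  refine Sum.inr_injective (hG (Sum.inr c₁) (Sum.inr c₂) γ₁ γ₂ ?_)
  rw [← h', inf_idem, Subgroup.subgroupOf_self, Subgroup.coe_top]
  exact isOpen_univ

/-- Each representative `Π_c` is a cuspidal subgroup. [cite: MochizukiCombGC2007, Def 1.1(ii) p.7] -/
theorem isCuspidal_cuspGp (c : G.graph.C) : G.IsCuspidal (G.cuspGp c) :=
  ⟨c, 1, (one_smul _ _).symm⟩

end Cusps

/-! ### The bijection of cusps induced by a group-theoretically cuspidal `α` -/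

section Transport

variable {G : PSCDatum P} {H : PSCDatum P'} {α : P ≃ₜ* P'}

/-- Conjugates of images: if `α(S) = δ₁ T₁` and `α(S') = δ₂ T₁'` with `T₁ = T₁'`-class data, then
`S'` is a conjugate of `S` as soon as `α(S')` is a conjugate of `α(S)` — the pull-back of a conjugacy
along `α`. [cite: MochizukiCombGC2007, Prop 1.5(ii) p.13] -/
theorem exists_smul_eq_of_map_eq_smul_map {S S' : Subgroup P} {δ : ConjAct P'}
    (h : S'.map α.toMulEquiv.toMonoidHom = δ • S.map α.toMulEquiv.toMonoidHom) :
    ∃ γ : ConjAct P, S' = γ • S := by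
  refine ⟨ConjAct.toConjAct (α.symm (ConjAct.ofConjAct δ)), ?_⟩
  have hback : ∀ T : Subgroup P,
      (T.map α.toMulEquiv.toMonoidHom).map α.symm.toMulEquiv.toMonoidHom = T := fun T => by
    rw [Subgroup.map_map]
    convert Subgroup.map_id T
    ext x
    exact α.symm_apply_apply x
  have := congrArg (Subgroup.map α.symm.toMulEquiv.toMonoidHom) h
  rw [hback, map_conj_smul, hback] at this
  exact this

/-- **The cusp bijection** (proof of Prop. 1.5 (ii), p. 13, cuspidal part; used for Thm. 1.6 (i)):
for `α` group-theoretically cuspidal and `G`, `H` satisfying Prop. 1.2 (i) for edge-like subgroups,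
there is a bijection `f : cusps(G) ≃ cusps(H)` with `α(Π_c)` a conjugate of `Π'_{f c}` for every cusp
`c`. [cite: MochizukiCombGC2007, Prop 1.5(ii) p.13] -/
theorem exists_cuspEquiv_of_isGroupTheoreticallyCuspidal (hG : G.EdgeLikeOpenInterDeterminesEdge)
    (hH : H.EdgeLikeOpenInterDeterminesEdge) (h : G.IsGroupTheoreticallyCuspidal H α) :
    ∃ f : G.graph.C ≃ H.graph.C, ∀ c, ∃ δ : ConjAct P',
      (G.cuspGp c).map α.toMulEquiv.toMonoidHom = δ • H.cuspGp (f c) := by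
  classical
  have himg : ∀ c, ∃ c' : H.graph.C, ∃ δ : ConjAct P',
      (G.cuspGp c).map α.toMulEquiv.toMonoidHom = δ • H.cuspGp c' :=
    fun c => h.1 _ (G.isCuspidal_cuspGp c)
  choose f δ hf using himg
  have hinj : Function.Injective f := by
    intro c₁ c₂ heq
    have h2 : (G.cuspGp c₂).map α.toMulEquiv.toMonoidHom =
        (δ c₂ * (δ c₁)⁻¹) • (G.cuspGp c₁).map α.toMulEquiv.toMonoidHom := by
      rw [mul_smul, hf c₁, inv_smul_smul, hf c₂, heq]
    obtain ⟨γ, hγ⟩ := exists_smul_eq_of_map_eq_smul_map h2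
    have := G.cusp_eq_of_smul_cuspGp_eq hG
      (show (1 : ConjAct P) • G.cuspGp c₂ = γ • G.cuspGp c₁ by rw [one_smul]; exact hγ)
    exact this.symm
  have hsurj : Function.Surjective f := by
    intro c'
    obtain ⟨A, ⟨c, γ, rfl⟩, hA⟩ := h.2 _ (H.isCuspidal_cuspGp c')
    refine ⟨c, ?_⟩
    -- `α(γ Π_c) = Π'_{c'}` and `α(Π_c) = δ c • Π'_{f c}` ⟹ `Π'_{c'}` and `Π'_{f c}` are conjugate
    rw [map_conj_smul, hf c, smul_smul, ← one_smul (ConjAct P') (H.cuspGp c')] at hA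
    exact H.cusp_eq_of_smul_cuspGp_eq hH hA
  exact ⟨Equiv.ofBijective f ⟨hinj, hsurj⟩, fun c => ⟨δ c, hf c⟩⟩

/-- **[CombGC] Theorem 1.6 (i), sufficiency** ("Sufficiency is immediate [cf. Proposition 1.2,
(i)]", p. 13), PROVED over the interface for all data `G`, `H` satisfying the conclusion of Prop.
1.2 (i) for edge-like subgroups: a group-theoretically cuspidal `α : Π_G ≅ Π_H` is numerically
cuspidal — for every open `U ≤ Π_G`, `r(G_U) = r(H_{α U})`, cusp by cusp.
[cite: MochizukiCombGC2007, Thm 1.6(i) p.13] -/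
theorem isNumericallyCuspidal_of_isGroupTheoreticallyCuspidal (hG : G.EdgeLikeOpenInterDeterminesEdge)
    (hH : H.EdgeLikeOpenInterDeterminesEdge) (h : G.IsGroupTheoreticallyCuspidal H α) :
    G.IsNumericallyCuspidal H α := by
  obtain ⟨f, hf⟩ := exists_cuspEquiv_of_isGroupTheoreticallyCuspidal hG hH h
  intro U _
  unfold cuspCount
  rw [← Equiv.sum_comp f]
  refine Finset.sum_congr rfl fun c _ => ?_
  obtain ⟨δ, hδ⟩ := hf c
  have : H.cuspGp (f c) = δ⁻¹ • (G.cuspGp c).map α.toMulEquiv.toMonoidHom := by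
    rw [hδ, inv_smul_smul]
  rw [this, card_doubleCoset_quotient_conj, card_doubleCoset_quotient_map]

/-- **[CombGC] Theorem 1.6 (i), sufficiency**, bundled half of the typed predicate
`NumericallyCuspidalIffGroupTheoreticallyCuspidal`: its `←` direction, from Prop. 1.2 (i) for `G`
and `H`. [cite: MochizukiCombGC2007, Thm 1.6(i) p.13] -/
theorem numericallyCuspidalIff_mpr (hG : G.EdgeLikeOpenInterDeterminesEdge)
    (hH : H.EdgeLikeOpenInterDeterminesEdge) :
    G.IsGroupTheoreticallyCuspidal H α → G.IsNumericallyCuspidal H α :=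
  isNumericallyCuspidal_of_isGroupTheoreticallyCuspidal hG hH

end Transport

end PSCDatum

end Literature.AnabelianGeometry.SemiGraphs

end
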